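import Mathlib
import HarnessLib
import Literature.MathematicalPhysics.QuantumLattice.GaugeGroups
import Literature.MathematicalPhysics.QuantumFieldTheory.ConstructiveQFTWave0
import Literature.MathematicalPhysics.QuantumFieldTheory.U1GinibreComparison
import Summits.Ventures.LatticeQCDFlow.Scaling.LatticeEntropyU1

/-!
# LatticeQCDFlow / Scaling — `U(1)`: an extensive-action configuration at every volume `L ≥ 2`
(the missing input of (C2a-R) for abelian `G`; v2.5)

HONEST FRAMING: exact (Metropolis-corrected) sampling algorithms for lattice gauge theory; figures
of merit are autocorrelation/cost numbers at stated couplings and volumes; no continuum-physics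
claim.

Venture `LatticeQCDFlow` (cell pub-lqcd), topic `Scaling`, FANOUT row 29 (theory2) — OUR WORK
(THEORY-2.md v2.5 §3.3, §4 row C2a).  Row 30 settled the exact-transport item (C2a)
`Conjectures.ExactTransportBiLipschitz`: TRUE for `SU(N)`/`U(N)`, `N ≥ 2`, `d ≥ 2`
(`exactTransportBiLipschitz_of_ballVolumes` + Haar ball volumes + an extensive-action
configuration at EVERY `L ≥ 1`), FALSE for abelian `G` because at `L = 1` every abelian plaquette
is `U V U⁻¹ V⁻¹ = 1` and the Wilson action vanishes identically.  The repaired item (C2a-R)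
`Conjectures.ExactTransportBiLipschitzR` (`Scaling/ConjecturesRepaired.lean`) quantifies over
`L ≥ 2` only; for `G = U(1) = Circle` with its defining representation `u1Rep` the one missing
input of row 30's argument is then an extensive-action configuration at every `L ≥ 2`, which this
file supplies, with the explicit constant `3/2`:

* `twist d L hd` — the configuration `U(x, e₀) = exp(i·θ_L·x₁)`, all other links `1`, with the
  twist angle `θ_L = 2π⌊L/2⌋/L` (`twistAngle`);
* `cos_twist_step`, `re_trace_hol_twist` — every `(e₀, e₁)`-plaquette of `twist` has
  `Re tr = cos θ_L` (the wrap-around plaquette included: its angle differs by `2π⌊L/2⌋`);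
* `cos_twistAngle_le` — `θ_L ∈ [2π/3, π]` for `L ≥ 2`, so `cos θ_L ≤ −1/2`;
* `wilsonAction_twist_ge` — `S(twist) ≥ (3/2)·L^d` (the other plaquettes contribute `≥ 0`);
* `extensive_action` — `∀ L ≥ 2, ∃ V, (3/2)·L^d ≤ S(V)` in dimension `d ≥ 2`, the `hconf`
  hypothesis of row 30's theorem restricted to `L ≥ 2` (at `L = 1` no such `V` exists:
  `wilsonAction_eq_zero_of_comm`).
Elementary; nothing is cited as a fact.
-/

noncomputable section

open MeasureTheory Real Set
open Literature.MathematicalPhysics.QuantumFieldTheory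
open Literature.MathematicalPhysics.QuantumLattice (u1Rep u1Rep_apply continuous_u1Rep)

namespace Summit.Ventures.LatticeQCDFlow.Theory2.Lattice.U1

variable {d : ℕ}

/-- The direction `e₀` (needs `d ≥ 1`). [folklore] -/
def dir0 (hd : 2 ≤ d) : Fin d := ⟨0, by omega⟩

/-- The direction `e₁` (needs `d ≥ 2`). [folklore] -/
def dir1 (hd : 2 ≤ d) : Fin d := ⟨1, by omega⟩

/-- `e₀ ≠ e₁`. [folklore] -/
theorem dir1_ne_dir0 (hd : 2 ≤ d) : dir1 hd ≠ dir0 hd := by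
  simp [dir0, dir1, Fin.ext_iff]

/-- `e₀ < e₁`. [folklore] -/
theorem dir0_lt_dir1 (hd : 2 ≤ d) : dir0 hd < dir1 hd :=
  Fin.mk_lt_mk.2 (by norm_num)

/-- The twist angle `θ_L = 2π⌊L/2⌋/L`. [folklore] -/
def twistAngle (L : ℕ) : ℝ := 2 * π * ((L / 2 : ℕ) : ℝ) / L

/-- `cos θ_L ≤ −1/2` for `L ≥ 2` (`θ_L ∈ [2π/3, π]`). [folklore] -/
theorem cos_twistAngle_le {L : ℕ} (hL : 2 ≤ L) : Real.cos (twistAngle L) ≤ -(1 / 2 : ℝ) := by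
  have hL0 : (0 : ℝ) < L := by exact_mod_cast (by omega : 0 < L)
  have h2k : ((2 : ℕ) : ℝ) * ((L / 2 : ℕ) : ℝ) ≤ L := by exact_mod_cast Nat.mul_div_le L 2
  have h3k : (L : ℝ) ≤ 3 * ((L / 2 : ℕ) : ℝ) := by exact_mod_cast (by omega : L ≤ 3 * (L / 2))
  have hθ1 : 2 * π / 3 ≤ twistAngle L := by
    unfold twistAngle
    rw [div_le_div_iff₀ (by norm_num) hL0]
    nlinarith [Real.pi_pos]
  have hθ2 : twistAngle L ≤ π := by
    unfold twistAngle
    rw [div_le_iff₀ hL0]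
    push_cast at h2k
    nlinarith [Real.pi_pos]
  calc Real.cos (twistAngle L) ≤ Real.cos (2 * π / 3) :=
        Real.cos_le_cos_of_nonneg_of_le_pi (by positivity) hθ2 hθ1
    _ = -(1 / 2 : ℝ) := by
        rw [show 2 * π / 3 = π - π / 3 by ring, Real.cos_pi_sub, Real.cos_pi_div_three]

/-- The twisted configuration: `U(x, e₀) = exp(i θ_L x₁)`, all other links `1`. [folklore] -/
def twist (d L : ℕ) (hd : 2 ≤ d) : GaugeConfig d L Circle := fun e =>
  if e.2 = dir0 hd then Circle.exp (twistAngle L * ((e.1 (dir1 hd)).val : ℝ)) else 1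

/-- The `(e₀, e₁)`-plaquette holonomy of `twist` at `x` is `exp(i θ_L (x₁ − (x₁ + 1)))` (values
of `ZMod L` read in `{0, …, L−1}`). [folklore] -/
theorem plaquetteHolonomy_twist {L : ℕ} (hd : 2 ≤ d) (x : Site d L) :
    plaquetteHolonomy (twist d L hd) x (dir0 hd) (dir1 hd) =
      Circle.exp (twistAngle L * ((x (dir1 hd)).val : ℝ) -
        twistAngle L * (((x (dir1 hd)) + 1).val : ℝ)) := by
  have h10 := dir1_ne_dir0 hd
  have hs1 : (x.shift (dir1 hd)) (dir1 hd) = x (dir1 hd) + 1 := by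
    simp [Site.shift]
  unfold plaquetteHolonomy
  simp only [twist, if_neg h10, hs1, mul_one, inv_one, Circle.exp_sub, div_eq_mul_inv,
    reduceIte]

/-- The step identity `cos(θ_L·a − θ_L·(a+1)) = cos θ_L` for `a : ZMod L` read in
`{0, …, L−1}`: the wrap-around step `a = L − 1` differs by the multiple `2π⌊L/2⌋` of `2π`.
[folklore] -/
theorem cos_twist_step {L : ℕ} [NeZero L] (hL : 2 ≤ L) (a : ZMod L) :
    Real.cos (twistAngle L * (a.val : ℝ) - twistAngle L * ((a + 1).val : ℝ)) =
      Real.cos (twistAngle L) := by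
  have h1 : (a + 1).val = (a.val + 1) % L := by
    haveI : Fact (1 < L) := ⟨by omega⟩
    rw [ZMod.val_add, ZMod.val_one]
  have h2 : (((a.val + 1) % L : ℕ) : ℝ) + (L : ℝ) * (((a.val + 1) / L : ℕ) : ℝ) =
      (a.val : ℝ) + 1 := by
    exact_mod_cast Nat.mod_add_div (a.val + 1) L
  have hL0 : (L : ℝ) ≠ 0 := by exact_mod_cast (by omega : L ≠ 0)
  have h3 : twistAngle L * (a.val : ℝ) - twistAngle L * (((a + 1).val : ℕ) : ℝ) =
      (((L / 2) * ((a.val + 1) / L) : ℕ) : ℝ) * (2 * π) - twistAngle L := by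
    rw [h1]
    have h4 : (((a.val + 1) % L : ℕ) : ℝ) =
        (a.val : ℝ) + 1 - (L : ℝ) * (((a.val + 1) / L : ℕ) : ℝ) := by
      linarith
    rw [h4]
    unfold twistAngle
    push_cast
    field_simp
    ring
  rw [h3, Real.cos_nat_mul_two_pi_sub]

/-- Every `(e₀, e₁)`-plaquette of `twist` has `Re tr = cos θ_L`. [folklore] -/
theorem re_trace_hol_twist {L : ℕ} [NeZero L] (hL : 2 ≤ L) (hd : 2 ≤ d) (x : Site d L) :
    (u1Rep (plaquetteHolonomy (twist d L hd) x (dir0 hd) (dir1 hd))).trace.re =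
      Real.cos (twistAngle L) := by
  rw [plaquetteHolonomy_twist, trace_u1Rep_re, re_coe_exp, cos_twist_step hL]

/-- **`S(twist) ≥ (3/2)·L^d`** for `L ≥ 2`, `d ≥ 2`. [folklore] -/
theorem wilsonAction_twist_ge {L : ℕ} [NeZero L] (hd : 2 ≤ d) (hL : 2 ≤ L) :
    (3 / 2 : ℝ) * (L : ℝ) ^ d ≤ wilsonAction u1Rep (twist d L hd) := by
  unfold wilsonAction
  rw [Fintype.sum_prod_type]
  set q0 : {p : Fin d × Fin d // p.1 < p.2} := ⟨(dir0 hd, dir1 hd), dir0_lt_dir1 hd⟩ with hq0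
  have hnn : ∀ (x : Site d L) (q : {p : Fin d × Fin d // p.1 < p.2}),
      0 ≤ ((1 : ℕ) : ℝ) - (u1Rep (plaquetteHolonomy (twist d L hd) x q.1.1 q.1.2)).trace.re :=
    fun x q => sub_nonneg.2 (re_trace_u1Rep_le _)
  have hcard : (Fintype.card (Site d L) : ℝ) = (L : ℝ) ^ d := by
    rw [Fintype.card_fun, ZMod.card, Fintype.card_fin]
    push_cast
    rfl
  calc (3 / 2 : ℝ) * (L : ℝ) ^ d = ∑ _x : Site d L, (3 / 2 : ℝ) := by
        rw [Finset.sum_const, Finset.card_univ, nsmul_eq_mul, hcard, mul_comm]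
    _ ≤ ∑ x : Site d L, (((1 : ℕ) : ℝ) -
          (u1Rep (plaquetteHolonomy (twist d L hd) x (dir0 hd) (dir1 hd))).trace.re) := by
        refine Finset.sum_le_sum fun x _ => ?_
        rw [re_trace_hol_twist hL hd x]
        have := cos_twistAngle_le hL
        push_cast
        linarith
    _ ≤ ∑ x : Site d L, ∑ q : {p : Fin d × Fin d // p.1 < p.2}, (((1 : ℕ) : ℝ) -
          (u1Rep (plaquetteHolonomy (twist d L hd) (x, q).1 (x, q).2.1.1
            (x, q).2.1.2)).trace.re) := by
        refine Finset.sum_le_sum fun x _ => ?_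
        have h := Finset.single_le_sum (f := fun q : {p : Fin d × Fin d // p.1 < p.2} =>
          ((1 : ℕ) : ℝ) - (u1Rep (plaquetteHolonomy (twist d L hd) x q.1.1 q.1.2)).trace.re)
          (fun q _ => hnn x q) (Finset.mem_univ q0)
        simpa [hq0] using h

/-- **Extensive action for `U(1)` at every volume `L ≥ 2`** (`d ≥ 2`): the `hconf` input of row
30's `exactTransportBiLipschitz_of_ballVolumes`, restricted to `L ≥ 2` as (C2a-R) requires (at
`L = 1` it fails: `wilsonAction_eq_zero_of_comm`). [folklore] -/
theorem extensive_action (hd : 2 ≤ d) (L : ℕ) [NeZero L] (hL : 2 ≤ L) :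
    ∃ V : GaugeConfig d L Circle, (3 / 2 : ℝ) * (L : ℝ) ^ d ≤ wilsonAction u1Rep V :=
  ⟨twist d L hd, wilsonAction_twist_ge hd hL⟩

end Summit.Ventures.LatticeQCDFlow.Theory2.Lattice.U1

end
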